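import Summits.HodgeConjecture.HodgeConjecture.Theorems.K2E1bArchPacketSignsDefs   -- ★ E1b U8 leaf: generic `HasArchOpTrace`, letter `ArchPacketSignsLetter`
import Literature.NumberTheory.Rogawski1990.ArchimedeanTransfer                     -- ★ `archStableOrbitalIntegral`, `IsArchDeltaTransfer(Exists)`, `ArchSmooth(₂)`, `ArchTransferFactor`
import Literature.NumberTheory.Rogawski1990.ArchExplicitTransferFactorConjRight      -- ★ `archExplicitTransferFactor … (archExplicitDelta_conj_left …) (archExplicitDelta_conj_right …)` = print's `Δ″_∞`
import HarnessLib

/-!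
# R90-TF · S10 (Rogawski 1990 §13.8) · THEOREMS — `R90S10ArchSignKitDefs`: the DEFINITIONS of FILE E (archimedean pseudo-coefficient ∕ sign kit)

Cell hodgecm-mathlib, slab R90-TF (director brief v2), section S10 = §13.8 «Proofs of local results» (Props. 13.8.1–13.8.3), crux item h413 =
stmt-HodgeConjecture-24833 (route `route-HodgeConjecture-HCCMUnconditional`).  Pen: R90-C138-typ1 (g2) (DEAL #3 (2) of R90-C138-plan (g0); HEADS-E.v1
fcaaafca48503716 «=» 15:55:44Z; AUDIT S10#E 15:58:39Z E-F1…E-F5 folded).  LAW L9 «DEFINITIONS DOWN» (R90 bus S4-R5 15:56:41Z ∕ S2-R10 16:12:02Z): a socket is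
PAYABLE only if its payer's ★ `Theorems` file can state the socket's type WITHOUT importing the socket's own `Lines` file — so every DEFINITION the types of
FILE E's two stubs mention lands HERE, sorry-free over ★ `Theorems` ∕ ★ `Literature` only, and the `Lines` file E `R90_S10_ArchPseudoCoeffExtE` (= EXACTLY the two
named stubs (E-X1) `stub_R90_ext_pseudoCoeffDS_u`, (E-S1) `sock_S10_archTransferSigns_u`), typ4's C2∕B, typ2's D ED. 2 and every payer IMPORT this file, never
conversely.  It types the ARCHIMEDEAN INPUTS of the proof of Prop. 13.8.3 (p. 218 lines 11–28) on the ★ BLOCK archimedean carriers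
`G_∞ = U(Φ₃)(L⁺ ⊗ ℝ) = ↥(UnitaryGroup.arch L⁺ L c 3 Φ₃)` and `H_∞ = (U(Φ₂) × U(Φ₁))(L⁺ ⊗ ℝ)` — the carriers of ★ `IsArchDeltaTransfer`, ★ `archStableOrbitalIntegral`,
★ `PureTensor.arch`.

PRINT → DECL (Rogawski1990 §13.8, proof of Prop. 13.8.3, p. 218; §12.3 Prop. 12.3.2 p. 178; §4.1 (4.1.1) p. 39):
* L20–21 «`f_u` … such that the stable orbital integrals of `f_u` vanish» ↦ (E-D1) `IsArchStablyNull` (DEF; the instance at the frozen function is typ4's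
  HYPOTHESIS field `hSOu` — payable only for STABLY NORMALISED families, cf. (E-S1)'s (W)(C) hypotheses; never ★ `OrbitalMeasureFamily.IsCanonical` at `∞`);
* L22–24, L27–28 «`Tr π_u(f_u) ∈ {0, 1, −1}` for every irreducible unitary `π_u`» ↦ (E-D2) `IsArchSignTest` + PROVED read-off (E-R1) `ArchSignKit.isArchSignTest_frozenG`;
* L20–22 «pseudo-coefficients `f_{π}` of the discrete series members of the `L`-packet» ↦ (E-D4) `IsArchPseudoCoeffSystem` [ClozelDelorme] (INTEGRABLE packet, E-F5);
* L13, L22–25 «`f_u → f_u^H` and `Tr ρ_u(f_u^H) = Σ ⟨s, π⟩ Tr π(f_u)` (Prop. 12.3.2) ⇒ `Tr ρ_u(f_u^H) = 2`» ↦ (E-D3) `IsArchEndoCharId` + PROVED read-off (E-R2)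
  `ArchSignKit.hasArchOpTrace_two`;
* the data of L20–25 as ONE record ↦ (E-K) `structure ArchSignKit` (+ `ArchSignKit.frozenG := f k₁ − f k₂`, the archimedean factor of the FROZEN test function
  `f = f_u ⊗ ⊗_{v ≠ u} f_{1,v}` of L20; the index type `κ` is abstract and finite — for `r` real places of `L⁺` the block packet is `(Fin 3)^r`);
* print's archimedean transfer factor of record ↦ `archDeltaPP L μ := Δ″_∞` = ★ `archExplicitTransferFactor` at `Φ₃` (AUDIT S10#E E-F1 (a): PINNED, not quantified).

HONESTY.  ZERO `sorry`; ★-only imports (one ★ `Theorems` file + ★ `Literature`); no `Cruxes/…` import; no `instance`, no `notation`.  No `Prop` shell is posited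
as a field VALUE: every representation-level trace enters through the junk-free ★ predicate `HasArchOpTrace` (`HasSum` over EVERY Hilbert basis); the kit's `hpc`
δ-clause with `k₁ ≠ k₂`, `s k₁ = 1`, `s k₂ = −1` excludes the junk witnesses `f := 0` (★ `isArchDeltaTransfer_zero`) and constant sign vectors; `IsArchStablyNull`
is a DEF only (`isArchStablyNull_zero` shows the shape is inhabited).  The read-offs (E-R1), (E-R2) are PROVED from linearity of ★ `ContRepresentation.integratedOperator`.
Namespace `Summit.HodgeConjecture.HodgeConjecture.R90.S10` (brief v2 §3 (4); shared with the `Lines` file E — names of E-EXPORTS-FROZEN v1 unchanged).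

References: [cite: Rogawski1990, §13.8 Prop. 13.8.3 (proof) p. 218; §12.3 Prop. 12.3.2 p. 178; §12.6 p. 187; §4.1 (4.1.1) p. 39; §4.9 Prop. 4.9.1 (a) p. 55; §14.3 p. 234; §14.6 p. 242]
[cite: ClozelDelorme1984] [cite: Shelstad1983] [cite: Knapp1986, Thm. 10.2] [cite: DeitmarEchterhoff2014, Prop. 6.2.1]
-/

set_option autoImplicit false
set_option linter.dupNamespace false

noncomputable section

open NumberField MeasureTheory CompactlySupported
open scoped Matrix MatrixGroups InnerProductSpace ContDiff

namespace Summit.HodgeConjecture.HodgeConjecture.R90.S10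

open Literature.NumberTheory.Automorphic
open Literature.NumberTheory.Rogawski1990
open Literature.NumberTheory.GaloisRepresentations (HeckeCharacter)
open Summit.HodgeConjecture.HodgeConjecture.Cruxes.H413.K2E1bGKCohomologyU21.U8 (HasArchOpTrace hasArchOpTrace_iff ArchPacketSignsLetter)

/-! ## §0 The block archimedean carriers (reducible abbreviations of the ★ spellings; no notation) -/

/-- `Φ₃` — the antidiagonal Hermitian form of ★ `ArchimedeanTransfer` ∕ ★ `qsForm`: `(Φ₃)_{ij} = 1` iff `i + j + 1 = 3`. [cite: Rogawski1990, §14.3 p. 234] -/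
abbrev phi3 (L : Type) [Field L] : Matrix (Fin 3) (Fin 3) L :=
  Matrix.of fun i j : Fin 3 => if i.val + j.val + 1 = 3 then (1 : L) else 0

/-- `G_∞ = U(Φ₃)(L⁺ ⊗ ℝ)` as a type — ★ `UnitaryGroup.arch L⁺ L c 3 Φ₃` (a closed subgroup of `GL₃(L ⊗ ℝ)`), the `G`-side carrier of ★ `IsArchDeltaTransfer`.
[cite: Rogawski1990, §14.3 p. 234] -/
abbrev GInf (L : Type) [Field L] [NumberField L] [IsCMField L] : Type :=
  ↥(UnitaryGroup.arch (↥(maximalRealSubfield L)) L (IsCMField.complexConj L) 3 (phi3 L))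

/-- `H_∞ = (U(Φ₂) × U(Φ₁))(L⁺ ⊗ ℝ)` as a type — the `H`-side carrier of ★ `IsArchDeltaTransfer` ∕ ★ `ArchSmooth₂`. [cite: Rogawski1990, §14.3 p. 234] -/
abbrev HInf (L : Type) [Field L] [NumberField L] [IsCMField L] : Type :=
  ↥(UnitaryGroup.arch (↥(maximalRealSubfield L)) L (IsCMField.complexConj L) 2
      (Matrix.of fun i j : Fin 2 => if i.val + j.val + 1 = 2 then (1 : L) else 0)) ×
    ↥(UnitaryGroup.arch (↥(maximalRealSubfield L)) L (IsCMField.complexConj L) 1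
      (Matrix.of fun i j : Fin 1 => if i.val + j.val + 1 = 1 then (1 : L) else 0))

/-! ## §1 Generic junk-free trace predicates on a locally compact group (any carrier) -/

section Generic

variable {G : Type*} [Group G] [TopologicalSpace G] [MeasurableSpace G] [BorelSpace G]

/-- **(E-D2) `IsArchSignTest ν F`** — «`Tr π(F) ∈ {0, 1, −1}` for EVERY irreducible unitary representation `π`» (p. 218 L22–24 for `π_u` square-integrable,
L27–28 for the rest), each alternative in the junk-free ★ currency `HasArchOpTrace` (a `HasSum` over every Hilbert basis). [cite: Rogawski1990, §13.8 p. 218]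
[cite: Knapp1986, Thm. 10.2] -/
def IsArchSignTest (ν : Measure G) [IsFiniteMeasureOnCompacts ν] (F : C_c(G, ℂ)) : Prop :=
  ∀ (E : Type) [NormedAddCommGroup E] [InnerProductSpace ℂ E] [CompleteSpace E]
    (ϖ : ContRepresentation ℂ G E) (hu : ϖ.IsUnitary) (hsc : ϖ.IsStronglyContinuous), ϖ.IsTopIrreducible →
      HasArchOpTrace ν ϖ hu hsc F 0 ∨ HasArchOpTrace ν ϖ hu hsc F 1 ∨ HasArchOpTrace ν ϖ hu hsc F (-1)

/-- **(E-D4) `IsArchPseudoCoeffSystem ν EG ϖ hu hsc f`** — «`f k` is a pseudo-coefficient of `ϖ k`» for a finite family: (i) `Tr ϖ_k(f_{k′}) = δ_{k k′}`;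
(ii) every irreducible unitary `π` has `Tr π(f_k) ∈ {0, 1}`; (iii) no irreducible unitary `π` has `Tr π(f_k) = Tr π(f_{k′}) = 1` for `k ≠ k′`
(the members of an `L`-packet are pairwise inequivalent).  Clause (ii) is print's «`Tr(π(f_v)) = 0` for `π ≠ π_{1v}`» for EVERY irreducible `π` — true for an
INTEGRABLE discrete-series packet («`ρ` is chosen so that `Π(ρ_v)` is integrable», p. 218) with `f_k` the `d_π`-normalised (pseudo-)coefficients, and FALSE for
bare Clozel–Delorme pseudo-coefficients of a non-integrable packet (non-tempered unitary `π` have non-zero Euler–Poincaré traces): payers aim at the integrable,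
non-semi-regular packets of print's (i) (AUDIT S10#E E-F5). [cite: Rogawski1990, §13.8 p. 218; §12.6 p. 187] [cite: ClozelDelorme1984] -/
def IsArchPseudoCoeffSystem (ν : Measure G) [IsFiniteMeasureOnCompacts ν] {κ : Type} [DecidableEq κ]
    (EG : κ → Type) [∀ k, NormedAddCommGroup (EG k)] [∀ k, InnerProductSpace ℂ (EG k)] [∀ k, CompleteSpace (EG k)]
    (ϖ : ∀ k, ContRepresentation ℂ G (EG k)) (hu : ∀ k, (ϖ k).IsUnitary) (hsc : ∀ k, (ϖ k).IsStronglyContinuous)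
    (f : κ → C_c(G, ℂ)) : Prop :=
  (∀ k k', HasArchOpTrace ν (ϖ k) (hu k) (hsc k) (f k') (if k = k' then 1 else 0)) ∧
  (∀ (k : κ) (E : Type) [NormedAddCommGroup E] [InnerProductSpace ℂ E] [CompleteSpace E]
      (π : ContRepresentation ℂ G E) (hπu : π.IsUnitary) (hπsc : π.IsStronglyContinuous), π.IsTopIrreducible →
        HasArchOpTrace ν π hπu hπsc (f k) 0 ∨ HasArchOpTrace ν π hπu hπsc (f k) 1) ∧
  (∀ (k k' : κ) (E : Type) [NormedAddCommGroup E] [InnerProductSpace ℂ E] [CompleteSpace E]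
      (π : ContRepresentation ℂ G E) (hπu : π.IsUnitary) (hπsc : π.IsStronglyContinuous), π.IsTopIrreducible → k ≠ k' →
        HasArchOpTrace ν π hπu hπsc (f k) 1 → HasArchOpTrace ν π hπu hπsc (f k') 1 → False)

/-! ### Linearity read-offs of ★ `HasArchOpTrace` (from ★ `integratedOperator_add`) -/

/-- `π(F − F′) = π(F) − π(F′)` for the ★ integrated operator. [folklore] [cite: DeitmarEchterhoff2014, Prop. 6.2.1] -/
theorem integratedOperator_sub' {E : Type} [NormedAddCommGroup E] [InnerProductSpace ℂ E] [CompleteSpace E]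
    (ϖ : ContRepresentation ℂ G E) (hu : ϖ.IsUnitary) (hsc : ϖ.IsStronglyContinuous) (ν : Measure G) [IsFiniteMeasureOnCompacts ν]
    (F F' : C_c(G, ℂ)) :
    ϖ.integratedOperator hu hsc ν (F - F') = ϖ.integratedOperator hu hsc ν F - ϖ.integratedOperator hu hsc ν F' := by
  have h := ContRepresentation.integratedOperator_add (π := ϖ) hu hsc ν (F - F') F'
  rw [sub_add_cancel] at h
  rw [h, add_sub_cancel_right]

/-- **`Tr π(F) = a`, `Tr π(F′) = a′` ⟹ `Tr π(F − F′) = a − a′`** in the junk-free currency. [cite: Knapp1986, Thm. 10.2] -/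
theorem hasArchOpTrace_sub {ν : Measure G} [IsFiniteMeasureOnCompacts ν] {E : Type} [NormedAddCommGroup E] [InnerProductSpace ℂ E] [CompleteSpace E]
    {ϖ : ContRepresentation ℂ G E} {hu : ϖ.IsUnitary} {hsc : ϖ.IsStronglyContinuous} {F F' : C_c(G, ℂ)} {a a' : ℂ}
    (h : HasArchOpTrace ν ϖ hu hsc F a) (h' : HasArchOpTrace ν ϖ hu hsc F' a') :
    HasArchOpTrace ν ϖ hu hsc (F - F') (a - a') := by
  intro κ b
  have hs := (h κ b).sub (h' κ b)
  refine hs.congr_fun ?_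
  intro k
  rw [integratedOperator_sub' ϖ hu hsc ν F F', _root_.sub_apply, inner_sub_right]

end Generic

/-! ## §2 The block-level archimedean predicates of Prop. 13.8.3's proof -/

section Block

variable (L : Type) [Field L] [NumberField L] [IsCMField L]

/-- **(E-D1) `IsArchStablyNull L mG a`** — «the STABLE orbital integrals of `a` vanish» at every regular element of `G_∞` (p. 218 L20–21: `f_u = f_{π₁} − f_{π₂}`,
a difference of pseudo-coefficients of two members of ONE `L`-packet, is such a function when `mG` is stably normalised): verbatim the second branch of
★ `isArchInnerTransfer_iff` without its `Corresponds` antecedent, in the ★ currency `archStableOrbitalIntegral` ((4.1.1) with `κ` trivial).  A DEF only —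
its instance at the frozen test function is the HYPOTHESIS field `hSOu` of typ4's `S10Frozen`. [cite: Rogawski1990, §13.8 p. 218; §4.1 (4.1.1) p. 39] -/
def IsArchStablyNull {_hγ : ∀ γ : GInf L, MeasurableSpace (GInf L ⧸ Subgroup.centralizer ({γ} : Set (GInf L)))}
    (mG : OrbitalMeasureFamily (GInf L)) (a : GInf L → ℂ) : Prop :=
  ∀ γ : GInf L, IsRegularElt (γ.val : GL (Fin 3) (mixedEmbedding.mixedSpace L)) → archStableOrbitalIntegral L 3 (phi3 L) mG a γ = 0

/-- Unfolding `IsArchStablyNull`. [cite: Rogawski1990, §4.1 (4.1.1) p. 39] -/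
theorem isArchStablyNull_iff {_hγ : ∀ γ : GInf L, MeasurableSpace (GInf L ⧸ Subgroup.centralizer ({γ} : Set (GInf L)))}
    (mG : OrbitalMeasureFamily (GInf L)) (a : GInf L → ℂ) :
    IsArchStablyNull L mG a ↔
      ∀ γ : GInf L, IsRegularElt (γ.val : GL (Fin 3) (mixedEmbedding.mixedSpace L)) → archStableOrbitalIntegral L 3 (phi3 L) mG a γ = 0 :=
  Iff.rfl

/-- `IsArchStablyNull L mG 0` (the shape is not vacuous: the zero function is stably null). [cite: Rogawski1990, §4.1 (4.1.1) p. 39] -/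
theorem isArchStablyNull_zero {_hγ : ∀ γ : GInf L, MeasurableSpace (GInf L ⧸ Subgroup.centralizer ({γ} : Set (GInf L)))}
    (mG : OrbitalMeasureFamily (GInf L)) : IsArchStablyNull L mG (0 : GInf L → ℂ) := by
  intro γ _
  exact stableOrbitalIntegralRel_zero _ _ _

variable {_ha : ∀ a : HInf L, MeasurableSpace (HInf L ⧸ Subgroup.centralizer ({a} : Set (HInf L)))}
  {_hγ : ∀ γ : GInf L, MeasurableSpace (GInf L ⧸ Subgroup.centralizer ({γ} : Set (GInf L)))}

/-- **(E-D3) `IsArchEndoCharId L Tinf mH mG ν νH EG ϖ hu hsc s ρH huH hscH`** — the ARCHIMEDEAN ENDOSCOPIC CHARACTER IDENTITY of Prop. 12.3.2 for the block: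
for every smooth matched pair `FH → F` (★ `IsArchDeltaTransfer`, ★ `ArchSmooth₂`, ★ `ArchSmooth`), if `Tr ϖ_k(F) = c_k` for all members `k` of the packet then
`Tr ρ_∞(FH) = Σ_k s_k · c_k` — «`Tr ρ_u(f_u^H) = Σ ⟨s, π⟩ Tr π(f_u)`» (p. 218 L22–25), all traces junk-free (★ `HasArchOpTrace`).  Here `ρ` stands for
the `H_∞` `L`-PACKET `ρ_∞ = ⊗_{v|∞} ρ_v` read as ONE (reducible) unitary representation — the Hilbert direct sum of its `2^{r}` members (`r` = number of real
places; Prop. 11.2.1 (a) p. 161), so that `HasArchOpTrace νH ρ … FH c` is the STABLE packet trace `Σ_j Tr ρ_j(FH) = c` of Shelstad's identity (LHS of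
Prop. 12.3.2); irreducibility of `ρ` is deliberately NOT a field (R90-C138-plan F6 ∕ R-L9 16:19:10Z: typ4's H-cut is the full `t(ρ)`-fibre `J`).
[cite: Rogawski1990, §12.3 Prop. 12.3.2 p. 178; §13.8 p. 218] -/
def IsArchEndoCharId (Tinf : ArchTransferFactor L (phi3 L)) (mH : OrbitalMeasureFamily (HInf L)) (mG : OrbitalMeasureFamily (GInf L))
    [MeasurableSpace (GInf L)] [BorelSpace (GInf L)] (ν : Measure (GInf L)) [IsFiniteMeasureOnCompacts ν]
    [MeasurableSpace (HInf L)] [BorelSpace (HInf L)] (νH : Measure (HInf L)) [IsFiniteMeasureOnCompacts νH]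
    {κ : Type} [Fintype κ]
    (EG : κ → Type) [∀ k, NormedAddCommGroup (EG k)] [∀ k, InnerProductSpace ℂ (EG k)] [∀ k, CompleteSpace (EG k)]
    (ϖ : ∀ k, ContRepresentation ℂ (GInf L) (EG k)) (hu : ∀ k, (ϖ k).IsUnitary) (hsc : ∀ k, (ϖ k).IsStronglyContinuous)
    (s : κ → ℤ)
    {EH : Type} [NormedAddCommGroup EH] [InnerProductSpace ℂ EH] [CompleteSpace EH]
    (ρ : ContRepresentation ℂ (HInf L) EH) (huH : ρ.IsUnitary) (hscH : ρ.IsStronglyContinuous) : Prop :=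
  ∀ (F : C_c(GInf L, ℂ)) (FH : C_c(HInf L, ℂ)), ArchSmooth L 3 (phi3 L) ⇑F → ArchSmooth₂ L ⇑FH →
    IsArchDeltaTransfer L (phi3 L) Tinf mH mG ⇑FH ⇑F →
      ∀ c : κ → ℂ, (∀ k, HasArchOpTrace ν (ϖ k) (hu k) (hsc k) F (c k)) →
        HasArchOpTrace νH ρ huH hscH FH (∑ k, (s k : ℂ) * c k)

/-- **(E-K) `ArchSignKit L Tinf mH mG ν νH`** — the archimedean data of p. 218 L20–25 as ONE record: a finite index type `κ` of the block discrete-series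
`L`-packet `Π(φ_∞)`, its members `ϖ k` (irreducible unitary, on Hilbert spaces `EG k`), their pseudo-coefficients `f k` (★ `C_c`), endoscopic signs
`s : κ → ℤ` with two members `k₁ ≠ k₂` of signs `+1 ∕ −1` («dim_d(π₁) = 1, dim_d(π₂) = 0» ∕ `⟨s, π⟩`), the `H_∞`-representation `ρH` of the block
(the archimedean `L`-PACKET `ρ_∞` of `ρ = ρ(θ₂) ⊗ 𝟙 ∈ Π(H)` as ONE reducible representation `⊕_{members}` — its character is the STABLE packet character
`SΘ_{ρ_∞}` of Prop. 12.3.2's left-hand side; AUDIT S10#E2 E-N1), the pseudo-coefficient laws (E-D4), the character identity (E-D3), and smoothness of the frozen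
difference `f k₁ − f k₂`.  No trace VALUE is posited: every trace is a junk-free ★ `HasArchOpTrace` clause. [cite: Rogawski1990, §13.8 p. 218; §12.3 Prop. 12.3.2 p. 178]
[cite: ClozelDelorme1984] -/
structure ArchSignKit (Tinf : ArchTransferFactor L (phi3 L)) (mH : OrbitalMeasureFamily (HInf L)) (mG : OrbitalMeasureFamily (GInf L))
    [MeasurableSpace (GInf L)] [BorelSpace (GInf L)] (ν : Measure (GInf L)) [IsFiniteMeasureOnCompacts ν]
    [MeasurableSpace (HInf L)] [BorelSpace (HInf L)] (νH : Measure (HInf L)) [IsFiniteMeasureOnCompacts νH] : Type 1 where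
  /-- index type of the block `L`-packet (for `r` real places: `(Fin 3)^r`). -/
  κ : Type
  [instFintype : Fintype κ]
  [instDecEq : DecidableEq κ]
  /-- Hilbert spaces of the packet members. -/
  EG : κ → Type
  [instNACG : ∀ k, NormedAddCommGroup (EG k)]
  [instIPS : ∀ k, InnerProductSpace ℂ (EG k)]
  [instCS : ∀ k, CompleteSpace (EG k)]
  /-- the packet members `ϖ k` (unitary, strongly continuous, topologically irreducible). -/
  ϖ : ∀ k, ContRepresentation ℂ (GInf L) (EG k)
  hu : ∀ k, (ϖ k).IsUnitary
  hsc : ∀ k, (ϖ k).IsStronglyContinuous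
  hirr : ∀ k, (ϖ k).IsTopIrreducible
  /-- pseudo-coefficients. -/
  f : κ → C_c(GInf L, ℂ)
  hpc : IsArchPseudoCoeffSystem ν EG ϖ hu hsc f
  /-- endoscopic signs `⟨s, π⟩` and the two distinguished members. -/
  s : κ → ℤ
  k₁ : κ
  k₂ : κ
  hk : k₁ ≠ k₂
  hs₁ : s k₁ = 1
  hs₂ : s k₂ = -1
  /-- the frozen difference is a smooth test function (★ `ArchSmooth`, by restriction from `GL₃(L ⊗ ℝ)`). -/
  hsmFrozen : ArchSmooth L 3 (phi3 L) ⇑(f k₁ - f k₂)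
  /-- the `H_∞` `L`-packet of the block as ONE (reducible) unitary representation — the direct sum of its members, whose junk-free trace is the STABLE
  packet trace — and its character identity (E-D3). -/
  EH : Type
  [instNACGH : NormedAddCommGroup EH]
  [instIPSH : InnerProductSpace ℂ EH]
  [instCSH : CompleteSpace EH]
  ρH : ContRepresentation ℂ (HInf L) EH
  huH : ρH.IsUnitary
  hscH : ρH.IsStronglyContinuous
  hci : IsArchEndoCharId L Tinf mH mG ν νH EG ϖ hu hsc s ρH huH hscH

namespace ArchSignKit

variable {L}
variable {Tinf : ArchTransferFactor L (phi3 L)} {mH : OrbitalMeasureFamily (HInf L)} {mG : OrbitalMeasureFamily (GInf L)}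
  [MeasurableSpace (GInf L)] [BorelSpace (GInf L)] {ν : Measure (GInf L)} [IsFiniteMeasureOnCompacts ν]
  [MeasurableSpace (HInf L)] [BorelSpace (HInf L)] {νH : Measure (HInf L)} [IsFiniteMeasureOnCompacts νH]

/-- **The frozen archimedean test function `f_u ⊗ ⊗_{v|∞, v ≠ u} f_{1,v}` of p. 218 L20, block form: `f k₁ − f k₂`.** [cite: Rogawski1990, §13.8 p. 218] -/
def frozenG (𝔞 : ArchSignKit L Tinf mH mG ν νH) : C_c(GInf L, ℂ) :=
  𝔞.f 𝔞.k₁ - 𝔞.f 𝔞.k₂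

/-- `𝔞.frozenG = 𝔞.f 𝔞.k₁ - 𝔞.f 𝔞.k₂` (definitional). [cite: Rogawski1990, §13.8 p. 218] -/
theorem frozenG_def (𝔞 : ArchSignKit L Tinf mH mG ν νH) : 𝔞.frozenG = 𝔞.f 𝔞.k₁ - 𝔞.f 𝔞.k₂ := rfl

/-- The frozen test function is smooth (field `hsmFrozen`). [cite: Rogawski1990, §14.2 p. 233] -/
theorem archSmooth_frozenG (𝔞 : ArchSignKit L Tinf mH mG ν νH) : ArchSmooth L 3 (phi3 L) ⇑𝔞.frozenG :=
  𝔞.hsmFrozen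

/-- **(E-R1) READ-OFF «`Tr π(f) ∈ {0, 1, −1}` for every irreducible unitary `π` of `G_∞`»** (p. 218 L22–24, L27–28) — PROVED from the pseudo-coefficient laws
(E-D4) (ii)–(iii) and linearity of the ★ integrated operator. [cite: Rogawski1990, §13.8 p. 218] -/
theorem isArchSignTest_frozenG (𝔞 : ArchSignKit L Tinf mH mG ν νH) : IsArchSignTest ν 𝔞.frozenG := by
  intro E _ _ _ π hπu hπsc hirr
  obtain ⟨_, h01, hexcl⟩ := 𝔞.hpc
  have h1 := h01 𝔞.k₁ E π hπu hπsc hirr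
  have h2 := h01 𝔞.k₂ E π hπu hπsc hirr
  rw [frozenG_def]
  rcases h1 with h1 | h1 <;> rcases h2 with h2 | h2
  · exact Or.inl (by simpa using hasArchOpTrace_sub h1 h2)
  · exact Or.inr (Or.inr (by simpa using hasArchOpTrace_sub h1 h2))
  · exact Or.inr (Or.inl (by simpa using hasArchOpTrace_sub h1 h2))
  · exact (hexcl 𝔞.k₁ 𝔞.k₂ E π hπu hπsc hirr 𝔞.hk h1 h2).elim

/-- The traces of the frozen function on the packet members: `Tr ϖ_k(f k₁ − f k₂) = δ_{k k₁} − δ_{k k₂}`. [cite: Rogawski1990, §13.8 p. 218] -/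
theorem hasArchOpTrace_member_frozenG (𝔞 : ArchSignKit L Tinf mH mG ν νH) (k : 𝔞.κ) :
    letI := 𝔞.instDecEq; letI := 𝔞.instNACG; letI := 𝔞.instIPS; letI := 𝔞.instCS
    HasArchOpTrace ν (𝔞.ϖ k) (𝔞.hu k) (𝔞.hsc k) 𝔞.frozenG
      ((if k = 𝔞.k₁ then 1 else 0) - (if k = 𝔞.k₂ then 1 else 0)) := by
  letI := 𝔞.instNACG; letI := 𝔞.instIPS; letI := 𝔞.instCS
  obtain ⟨hδ, _, _⟩ := 𝔞.hpc
  exact hasArchOpTrace_sub (hδ k 𝔞.k₁) (hδ k 𝔞.k₂)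

/-- **(E-R2) READ-OFF «`Tr ρ_∞(f^H) = 2`»** (p. 218 L24–25: «Proposition 12.3.2 therefore gives `Tr(ρ_u(f_u^H)) = 2`») — PROVED: for every smooth `FH` matched
with the frozen function (★ `IsArchDeltaTransfer`), the character identity (E-D3) at `c_k = δ_{k k₁} − δ_{k k₂}` gives `Σ_k s_k c_k = s_{k₁} − s_{k₂} = 1 − (−1) = 2`.
[cite: Rogawski1990, §13.8 p. 218; §12.3 Prop. 12.3.2 p. 178] -/
theorem hasArchOpTrace_two (𝔞 : ArchSignKit L Tinf mH mG ν νH) (FH : C_c(HInf L, ℂ)) (hsmH : ArchSmooth₂ L ⇑FH)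
    (htr : IsArchDeltaTransfer L (phi3 L) Tinf mH mG ⇑FH ⇑𝔞.frozenG) :
    letI := 𝔞.instNACGH; letI := 𝔞.instIPSH; letI := 𝔞.instCSH
    HasArchOpTrace νH 𝔞.ρH 𝔞.huH 𝔞.hscH FH 2 := by
  letI := 𝔞.instFintype; letI := 𝔞.instDecEq
  have h := 𝔞.hci 𝔞.frozenG FH 𝔞.archSmooth_frozenG hsmH htr
    (fun k => (if k = 𝔞.k₁ then 1 else 0) - (if k = 𝔞.k₂ then 1 else 0)) (fun k => 𝔞.hasArchOpTrace_member_frozenG k)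
  have hsum : (∑ k, (𝔞.s k : ℂ) * ((if k = 𝔞.k₁ then 1 else 0) - (if k = 𝔞.k₂ then 1 else 0))) = 2 := by
    simp only [mul_sub, Finset.sum_sub_distrib, mul_ite, mul_one, mul_zero, Finset.sum_ite_eq', Finset.mem_univ, if_true,
      𝔞.hs₁, 𝔞.hs₂]
    push_cast
    norm_num
  rw [hsum] at h
  exact h

end ArchSignKit

/-- **`archDeltaPP L μ := Δ″_∞`** — PRINT'S archimedean transfer factor for `(H_∞, G_∞) = (U(Φ₂) × U(Φ₁), U(Φ₃))(L⁺ ⊗ ℝ)`, the ★ explicit factor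
`archExplicitTransferFactor L Φ₃ μ (archExplicitDelta_conj_left L Φ₃ μ) (archExplicitDelta_conj_right L Φ₃ μ)` («`Δ″_∞ = τ · D_{G∕H,∞} · Π_w κ_w`») at the
quasi-split form `Φ₃` — the archimedean twin of ★ `Pinned1383Letter`'s finite collection `finExplicitCollection L (qsForm L) μ …`, so that S10 feeds ONE global
collection `{Δ″_v}`; `μ` is the Hecke character of the prefix ⟪P⟫.  A reducible abbreviation (AUDIT S10#E E-F1 (a): the factor of record is PINNED, not quantified).
[cite: Rogawski1990, §4.9 p. 55; §14.6 p. 242] -/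
abbrev archDeltaPP (μ : HeckeCharacter L) : ArchTransferFactor L (phi3 L) :=
  archExplicitTransferFactor L (phi3 L) μ (archExplicitDelta_conj_left L (phi3 L) μ) (archExplicitDelta_conj_right L (phi3 L) μ)

end Block

end Summit.HodgeConjecture.HodgeConjecture.R90.S10

end
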